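/-
Copyright (c) 2026 the pub-hodgecm-mathlib formalisation cell (harness21).  R90-TF SLAB, section S8 walk-in (chair VALVE S10 → S8), prover R90-C138-p02 (g2) —
DEAL «FACT-N (c-i) LOCAL» (S8 dealer R90-CS-plan (g4), S8-R308 (2), 2026-09-05T04:15:36Z); consumer K2Liu-p10 (g7) (w6-a) `dictionary_D2_of_tensorClause`;
h413 = `stmt-HodgeConjecture-24833`, route `HCCMUnconditional`.
-/
import Summits.HodgeConjecture.HodgeConjecture.Theorems.K2E3RankOneIntertwiningIntegralConvergence   -- ★ RUNG 3 (K2E3-p04): `exists_intertwiningIntegral_of_modulus` — `J(w₀, χ) ≠ 0` with its integral formula, `|χ₁| = ‖·‖^σ`, `σ > 0`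
import Summits.HodgeConjecture.HodgeConjecture.Theorems.R90S4LdsDecompOfReducible                   -- ★ (S4): `norm_apply_eq_one_of_isQuadraticCharExtension` (`|μ| = 1`); brings ★ `norm_apply_normOneUnits_eq_one` (`|η| = 1` on `E¹_v`)
import Literature.NumberTheory.Automorphic.UnitaryGroupPrincipalSeriesExponents                     -- ★ `cmWeylTorusCharPair` (+ `_eq`, `rfl`), `cmXiTorusChar_eq_cmTorusCharPair` (`rfl`), `conjInvChar`
import Literature.NumberTheory.Automorphic.CMLocalRingModulusContinuous                             -- ★ `continuous_cmXiTorusChar_fst` (continuity of `χ_ξ,1 = η̃₁ · μ · ‖·‖^{1∕2}`)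
import Literature.NumberTheory.Rogawski1990.CMLocalAPacketMembers                                   -- ★ `KeysCaseTwoLabels`, `Gqs`, `qsForm` (the consumer's label currency)
import HarnessLib

/-!
# R90-TF ∕ S8 — FACT-N (c-i) LOCAL AT THE DISTINGUISHED NON-SPLIT PLACE: the local intertwining operator `N_v = J(w₀, χ_ξ) : i_G(χ_ξ) → i_G(wχ_ξ)` OF RECORD EXISTS IN THE
# TREE and is NON-ZERO (the consumer's `f`, `hf0` DISCHARGED); the target letter `hσ` is bridged from the pinned dual orientation
# (`Theorems/R90S8LocalIntertwiningSphericalLettersU3.lean`; ns `Summit.HodgeConjecture.HodgeConjecture.R90.S8`; THEOREMS ONLY — no `def`, no instance, no notation, no named fact,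
# no `sorry`; ★ `Theorems` ∕ `Literature` imports only)

Print: [MoeglinWaldspurger1995] IV.1.9–IV.1.11 (the local factors `N_v(π_v, z)` of `M(w, π)`, holomorphic and non-zero at the residual point), II.1.6;
[Rogawski1990] §12.2 (2) pp. 173–174 («`i_G(χ_ξ)`, `χ_ξ = (η̃₁ μ ‖·‖^{1∕2}, η₂)`, has exactly the constituents `π²(ξ)`, `πⁿ(ξ)`; `πⁿ(ξ)` is the Langlands quotient» — the image
of the long intertwining operator), §4.5 p. 45; [Casselman1995] §6.4 pp. 62–64 (convergence of `T_w` for `|χ(a_α)| < 1`; `T_w φ_K = c_w(χ) φ'_K`); [Keys1984] §3, §7.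

## THE CONSUMER'S BINDERS (★ p865340 `R90S8ResMidSectionDictionaryIntertwinerU3.lean` :116–:118 ≡ K2Liu-p10 (g7) `R90S8ResMidGlobalDictionaryDataU3.lean` :157–:159)
At the distinguished NON-SPLIT place `v` of the Keys data (`hns`, `hμ : IsQuadraticCharExtension … μ`, `η₁ η₂`, continuity, labels `KeysCaseTwoLabels L v μ η₁ η₂ πs πn`):
`(f : (UnitaryGroup.cmPrincipalSeries L 3 v (UnitaryGroup.cmXiTorusChar L v μ η₁ η₂)).IntertwiningMap τ)` — the residual-point local factor `N_v(3∕2)` into a target `τ`;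
`(hσ : ∀ (r : SmoothIrrep (Gqs L v)) (N' : Subrepresentation τ), Nonempty (r.ρ.Equiv N'.toRepresentation) → IrrClass.mk r ≠ πs)` — `τ` has no `π²(ξ_v)`-subrepresentation;
`(hf0 : f.toLinearMap ≠ 0)`.

## WHAT THIS FILE PAYS
* §1 **`norm_cmXiTorusChar_fst_eq_rpow_half`** — the RUNG-3 modulus clause for `χ_ξ,1 = η̃₁ · μ · ‖·‖^{1∕2}` DISCHARGED: `‖χ_ξ,1(x)‖ = ‖x‖^{1∕2}` (`|η̃₁| = 1` on the compact
  `E¹_v`, ★ `norm_apply_normOneUnits_eq_one`; `|μ| = 1`, ★ `norm_apply_eq_one_of_isQuadraticCharExtension`; `|‖x‖^{1∕2}| = ‖x‖^{1∕2}`).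
* §2 **`exists_localIntertwiner_cmXiTorusChar_ne_zero`** — THE OPERATOR OF RECORD: at the target OF RECORD `τ := i_G(wχ_ξ) = cmPrincipalSeries L 3 v (cmWeylTorusCharPair L v χ_ξ,1 η₂)`
  there is `f : i_G(χ_ξ) →_G i_G(wχ_ξ)` with **`f.toLinearMap ≠ 0`** and `(f φ)(g) = ∫_{N(L⁺_v)} φ(w₀ n g) dn` — ★ RUNG 3 `exists_intertwiningIntegral_of_modulus` at `σ = 1∕2 > 0` (the
  intertwining integral CONVERGES because `Re χ_ξ,1 = +1∕2`).  So the consumer's `f` and `hf0` are TREE OBJECTS, not letters, once `τ` is the target of record.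
  (On the `K_v`-spherical line, for unramified data, ★ `K2E3IntertwiningIntegralSphericalLine.exists_intertwiningIntegral_sphericalVector_eq_smul` and ★
  `K2E3SphericalCFunctionMacdonald.exists_intertwiningIntegral_sphericalVector_eq_macdonald_smul` give `f f_K = c_w(χ_ξ) • f'_K` with Macdonald's `c_w` by name — not restated.)
* §3 **`hσ` BRIDGE** — `target_no_sub_of_class_of_subOrientation`: from the PINNED dual-orientation clause «every irreducible SUBrepresentation of `τ` has class `πⁿ(ξ_v)`»
  (`hτn`, print-true for `τ = i_G(wχ_ξ)`: `πⁿ(ξ_v)` is its unique irreducible subrepresentation [Rogawski1990 §12.2 (2); Casselman1995 §6.4]) and `πs ≠ πn` (★ `KeysCaseTwoLabels`.1),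
  the consumer's `hσ` BYTES VERBATIM; `_of_keysCaseTwoLabels` reads `πs ≠ πn` off the labels.
RESIDUE after this file (honest): the dual orientation «ORIENT^w» at the target (same (M-c) class as ★ Literature `KeysOrientation`, which orients `i_G(χ_ξ)` only — its (i)∕(iii) do
not exclude `π²(ξ_v) ↪ i_G(wχ_ξ)`: the split module `π² ⊕ πⁿ` passes ★ `K2E3IntertwinerSpaceDimEqOne` ∕ ★ `K2E3PSRegularReducibleCompZero` too), TENSOR-N `hA`, SEC-DICT.
HONEST LABEL: §2 pays the EXISTENCE and NON-VANISHING of `N_v(3∕2)` at the distinguished place (two binders of the (D2) column leave the letter list when `τ` is the target of record);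
§3 is a bridge over a named residual; HC_CM is proved only modulo the 7 printed citations (2 remaining named inputs: hLiu418 = `stmt-HodgeConjecture-24832`, h413 =
`stmt-HodgeConjecture-24833`) until rung 0 closes; REL ≠ ★ ≠ BUILT; count-neutral.
-/

set_option autoImplicit false
set_option linter.dupNamespace false  -- the mandated namespace `…HodgeConjecture.HodgeConjecture.R90.S8` repeats the summit's segment

noncomputable section

open NumberField IsDedekindDomain MeasureTheory
open scoped Matrix NNReal ENNReal MatrixGroups

open Literature.NumberTheory Literature.NumberTheory.Automorphic Literature.NumberTheory.Automorphic.UnitaryGroup Literature.NumberTheory.Rogawski1990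
open Literature.NumberTheory.GaloisRepresentations Literature.NumberTheory.GaloisRepresentations.IsNonarchimedeanLocalField
open Summit.HodgeConjecture.HodgeConjecture.Cruxes.H413

namespace Summit.HodgeConjecture.HodgeConjecture.R90.S8

/-! ## §1 The modulus of `χ_ξ,1 = η̃₁ · μ · ‖·‖^{1∕2}` is `‖·‖^{1∕2}` -/

section Modulus

variable (L : Type) [Field L] [NumberField L] [IsCMField L] (v : HeightOneSpectrum (𝓞 ↥(maximalRealSubfield L)))
  (hns : ∀ w : PlacesOver L v, IsCMField.complexConj L • w.1 = w.1)

include hns in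
/-- **`‖χ_ξ,1(x)‖ = ‖x‖^{1∕2}`** for `χ_ξ,1 = η̃₁ · μ · ‖·‖^{1∕2}` (`η̃₁ = η₁ ∘ quotConj`) at a NON-SPLIT `v`: `|η₁| = 1` on the compact `E¹_v` (★ `norm_apply_normOneUnits_eq_one`), `|μ| = 1`
for a quadratic-extension character (★ `norm_apply_eq_one_of_isQuadraticCharExtension`, «in case (2), `χ` is unitary» up to `‖·‖^{1∕2}`), and `|‖x‖^{1∕2}| = ‖x‖^{1∕2}` — the modulus
clause `hχ₁` of ★ RUNG 3 `exists_intertwiningIntegral_of_modulus` at `σ = 1∕2`. [cite: Rogawski1990, §12.2 p. 173; §11.1 p. 161; §4.8 p. 51] -/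
theorem norm_cmXiTorusChar_fst_eq_rpow_half (μ : (LocalRing L v)ˣ →* ℂˣ) (η₁ : ↥(normOneUnits (conjLocal L (IsCMField.complexConj L) v)) →* ℂˣ)
    (hμ : IsQuadraticCharExtension (conjLocal L (IsCMField.complexConj L) v) μ) (hμc : Continuous fun x => ((μ x : ℂˣ) : ℂ))
    (h1c : Continuous fun x => ((η₁ x : ℂˣ) : ℂ)) (x : (LocalRing L v)ˣ) :
    ‖(((η₁.comp (quotConj (conjLocal L (IsCMField.complexConj L) v) (conjLocal_conjLocal_cm L v)) * μ * halfModulusChar (LocalRing L v)) x : ℂˣ) : ℂ)‖ =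
      ((unitModulusChar (LocalRing L v) x : ℝ≥0) : ℝ) ^ (1 / 2 : ℝ) := by
  have hη : ‖((η₁ (quotConj (conjLocal L (IsCMField.complexConj L) v) (conjLocal_conjLocal_cm L v) x) : ℂˣ) : ℂ)‖ = 1 :=
    F0P3cStCharTSPrincipalSeriesUnitary.norm_apply_normOneUnits_eq_one L v hns η₁ h1c _
  have hμ1 : ‖((μ x : ℂˣ) : ℂ)‖ = 1 := R90.S4.norm_apply_eq_one_of_isQuadraticCharExtension L v hns μ hμc hμ x
  have hh : ‖((halfModulusChar (LocalRing L v) x : ℂˣ) : ℂ)‖ = ((unitModulusChar (LocalRing L v) x : ℝ≥0) : ℝ) ^ (1 / 2 : ℝ) := by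
    rw [coe_halfModulusChar_apply, Complex.norm_real, Real.norm_of_nonneg (NNReal.coe_nonneg _), Real.coe_sqrt, Real.sqrt_eq_rpow]
  rw [MonoidHom.mul_apply, MonoidHom.mul_apply, MonoidHom.comp_apply, Units.val_mul, Units.val_mul, norm_mul, norm_mul, hη, hμ1, hh, one_mul, one_mul]

end Modulus

/-! ## §2 The operator of record `N_v = J(w₀, χ_ξ) : i_G(χ_ξ) → i_G(wχ_ξ)` exists and is non-zero -/

section Operator

variable (L : Type) [Field L] [NumberField L] [IsCMField L] (v : HeightOneSpectrum (𝓞 ↥(maximalRealSubfield L)))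
  (hns : ∀ w : PlacesOver L v, IsCMField.complexConj L • w.1 = w.1)

set_option synthInstance.maxHeartbeats 400000 in
set_option maxHeartbeats 4000000 in -- statement over the `SmoothInd` carrier of ★ `cmPrincipalSeries` (class of ★ RUNG 3 ∕ ★ `K2E3IntertwiningIntegralSphericalLine`, measured there)
include hns in
/-- **FACT-N (c-i) LOCAL, EXISTENCE AND NON-VANISHING — the consumer's `f` and `hf0` at the target of record.**  `v` NON-SPLIT, `(μ, η₁, η₂)` case-(2) data (`μ|_{F_v^×} = ω`,
continuity), `w₀` of matrix `Φ₃`, `μ_N` a Haar measure of `N(L⁺_v)`.  Then there is an intertwining map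
`f : i_G(χ_ξ) = cmPrincipalSeries L 3 v (cmXiTorusChar L v μ η₁ η₂) → i_G(wχ_ξ) = cmPrincipalSeries L 3 v (cmWeylTorusCharPair L v (η̃₁ · μ · ‖·‖^{1∕2}) η₂)` with
**`f.toLinearMap ≠ 0`** and the integral formula `(f φ)(g) = ∫_N φ(w₀ n g) dμ_N` — the INTERTWINING INTEGRAL `J(w₀, χ_ξ)` of ★ RUNG 3 (`exists_intertwiningIntegral_of_modulus`), convergent
because `Re χ_ξ,1 = +1∕2 > 0` (§1).  This is the residual-point local factor `N_v(3∕2)` up to the (non-zero, finite) normalising scalar.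
[cite: MoeglinWaldspurger1995, IV.1.9–IV.1.11; II.1.6] [cite: Casselman1995, §6.4 pp. 62–64] [cite: Rogawski1990, §12.2 (2) pp. 173–174] [cite: Keys1984, §3] -/
theorem exists_localIntertwiner_cmXiTorusChar_ne_zero (μ : (LocalRing L v)ˣ →* ℂˣ)
    (η₁ η₂ : ↥(normOneUnits (conjLocal L (IsCMField.complexConj L) v)) →* ℂˣ)
    (hμ : IsQuadraticCharExtension (conjLocal L (IsCMField.complexConj L) v) μ) (hμc : Continuous fun x => ((μ x : ℂˣ) : ℂ))
    (h1c : Continuous fun x => ((η₁ x : ℂˣ) : ℂ)) (h2c : Continuous fun x => ((η₂ x : ℂˣ) : ℂ))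
    (w₀ : ↥(unitaryGroupOfForm (conjLocal L (IsCMField.complexConj L) v) (cmLocalForm L 3 v))) (hw₀ : Units.val (w₀ : GL (Fin 3) (LocalRing L v)) = cmLocalForm L 3 v)
    [MeasurableSpace ↥(cmBorelTriple L 3 v).N] [BorelSpace ↥(cmBorelTriple L 3 v).N] (μN : Measure ↥(cmBorelTriple L 3 v).N) [μN.IsHaarMeasure] :
    ∃ f : (cmPrincipalSeries L 3 v (cmXiTorusChar L v μ η₁ η₂)).IntertwiningMap
        (cmPrincipalSeries L 3 v (cmWeylTorusCharPair L v
          (η₁.comp (quotConj (conjLocal L (IsCMField.complexConj L) v) (conjLocal_conjLocal_cm L v)) * μ * halfModulusChar (LocalRing L v)) η₂)),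
      f.toLinearMap ≠ 0 ∧
      ∀ (φ : haveI := locallyCompactSpace_cmBorelU L 3 v
          Representation.SmoothInd (cmBorelTriple L 3 v).P
            (Representation.twist
              (((Representation.trivial ℂ ↥(torusU (conjLocal L (IsCMField.complexConj L) v) (cmLocalForm L 3 v)) ℂ).twist
                (cmXiTorusChar L v μ η₁ η₂)).comp (cmBorelTriple L 3 v).proj) (rootDeltaChar (cmBorelTriple L 3 v).P)))
        (g : ↥(unitaryGroupOfForm (conjLocal L (IsCMField.complexConj L) v) (cmLocalForm L 3 v))),
        (f φ).toFun g = ∫ n : ↥(cmBorelTriple L 3 v).N, φ.toFun (w₀ * (n : ↥(unitaryGroupOfForm (conjLocal L (IsCMField.complexConj L) v) (cmLocalForm L 3 v))) * g) ∂μN := by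
  obtain ⟨J, hJ, hint⟩ := K2E3RankOneIntertwiningIntegralConvergence.exists_intertwiningIntegral_of_modulus L v hns
    (η₁.comp (quotConj (conjLocal L (IsCMField.complexConj L) v) (conjLocal_conjLocal_cm L v)) * μ * halfModulusChar (LocalRing L v)) η₂
    (continuous_cmXiTorusChar_fst L v μ η₁ hμc h1c) h2c (by norm_num : (0 : ℝ) < 1 / 2)
    (norm_cmXiTorusChar_fst_eq_rpow_half L v hns μ η₁ hμ hμc h1c) w₀ hw₀ μN
  -- `J ≠ 0` as an intertwining map ⇒ its underlying linear map is non-zero (Mathlib `IntertwiningMap.toLinearMap_injective`)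
  have hJ0 : J.toLinearMap ≠ 0 := fun h0 => hJ (Representation.IntertwiningMap.toLinearMap_injective _ _ (by simpa using h0))
  -- `i_G(χ_ξ)` ∕ `i_G(wχ_ξ)` are `i_G(cmTorusCharPair …)` ∕ `i_G(cmTorusCharPair (conjInvChar …) …)` by `rfl` (★ `cmXiTorusChar_eq_cmTorusCharPair`, ★ `cmWeylTorusCharPair_eq`)
  exact ⟨J, hJ0, hint⟩

end Operator

/-! ## §3 The target letter `hσ` from the pinned dual orientation -/

section Target

variable {L : Type} [Field L] [NumberField L] [IsCMField L] {v : HeightOneSpectrum (𝓞 ↥(maximalRealSubfield L))}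
  {W : Type*} [AddCommGroup W] [Module ℂ W]
  {τ : Representation ℂ ↥(unitaryGroupOfForm (UnitaryGroup.conjLocal L (IsCMField.complexConj L) v) (UnitaryGroup.cmLocalForm L 3 v)) W}
  {πs πn : IrrClass (Gqs L v)}

/-- **THE `hσ` BRIDGE** — if every irreducible SUBrepresentation of the target `τ` has class `πⁿ(ξ_v) = πn` (the pinned dual orientation `hτn`; print-true for `τ = i_G(wχ_ξ)`, whose unique
irreducible subrepresentation is the Langlands quotient `πⁿ(ξ_v)` of `i_G(χ_ξ)`) and `πs ≠ πn`, then `τ` has NO subrepresentation of class `π²(ξ_v) = πs` — the consumer's `hσ` binder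
BYTES VERBATIM. [cite: Rogawski1990, §12.2 (2) pp. 173–174; §11.4 p. 164] [cite: Casselman1995, §6.4] [cite: MoeglinWaldspurger1995, IV.1.9–IV.1.11] -/
theorem target_no_sub_of_class_of_subOrientation (hne : πs ≠ πn)
    (hτn : ∀ (r : SmoothIrrep (Gqs L v)) (N' : Subrepresentation τ), Nonempty (r.ρ.Equiv N'.toRepresentation) → IrrClass.mk r = πn) :
    ∀ (r : SmoothIrrep (Gqs L v)) (N' : Subrepresentation τ), Nonempty (r.ρ.Equiv N'.toRepresentation) → IrrClass.mk r ≠ πs :=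
  fun r N' e hs => hne (hs.symm.trans (hτn r N' e))

/-- **THE `hσ` BRIDGE off the Keys labels**: `KeysCaseTwoLabels L v μ η₁ η₂ πs πn` carries `πs ≠ πn` (★ `keysCaseTwoLabels_iff`), so the pinned dual orientation `hτn` alone yields the
consumer's `hσ`. [cite: Rogawski1990, §12.2 (2) pp. 173–174] -/
theorem target_no_sub_of_class_of_keysCaseTwoLabels {μ : (UnitaryGroup.LocalRing L v)ˣ →* ℂˣ}
    {η₁ η₂ : ↥(UnitaryGroup.normOneUnits (UnitaryGroup.conjLocal L (IsCMField.complexConj L) v)) →* ℂˣ}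
    (hK : KeysCaseTwoLabels L v μ η₁ η₂ πs πn)
    (hτn : ∀ (r : SmoothIrrep (Gqs L v)) (N' : Subrepresentation τ), Nonempty (r.ρ.Equiv N'.toRepresentation) → IrrClass.mk r = πn) :
    ∀ (r : SmoothIrrep (Gqs L v)) (N' : Subrepresentation τ), Nonempty (r.ρ.Equiv N'.toRepresentation) → IrrClass.mk r ≠ πs :=
  target_no_sub_of_class_of_subOrientation hK.1 hτn

end Target

end Summit.HodgeConjecture.HodgeConjecture.R90.S8

end
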